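import Summits.QuantumAdvantage.QuantumAdvantage.Theorems.LinnikCubicClassGroupsDegreeOnePrimesEscapeClassPNTNoExceptional
import Summits.QuantumAdvantage.QuantumAdvantage.Theorems.LinnikCubicClassGroupsDegreeOnePrimesEscapePerCharacterDeficitCounting
import Literature.NumberTheory.LFunctions.UniformClassGroupPNTChebyshev
import HarnessLib

/-!
# Linnik's theorem for DEGREE-ONE prime ideals in every ideal class, odd degree (in particular cubic)

Topic `Summits/QuantumAdvantage/QuantumAdvantage/Theorems`, cell B2b-1 (linnik-cubic), PART A seat 4;
helper for the crux `DegreeOnePrimesEscape` (stmt-QuantumAdvantage-11543) of route `LinnikCubicClassGroups`.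
HONEST FRAMING: the value of this file is a THEOREM (kernel-checked, GRH-free, Siegel-free) — NOT summit
progress.

From the exceptional-term-free class prime number theorem in odd degree (`classPNT_eps_of_odd`, with
`ε = 1/2`: `π_C(x) ≥ Li(x)/(2h)`), the bound `h ≤ Q⁴` and the count of primes of residue degree `≥ 2`
(`π_K(x) ≤ Σ_C #{deg-1 primes ≤ x in C} + n(√x + 1)`, tree `primeIdealCount_le_sum_degOneClassCount_add`):

* `exists_degOnePrime_mem_class_absNorm_le_of_odd (n)` — **for odd `n > 1` there is `L > 0` such that
  every ideal class of every number field `K` of degree `n` contains a prime ideal `𝔭` of RESIDUE DEGREE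
  ONE (`N𝔭` prime) with `N𝔭 ≤ Q^{L}`**, `Q = |d_K|·nⁿ`;
* `exists_degOnePrime_mem_class_absNorm_le_cubic` — the cubic case (`Q = 27|d_K|`): the degree-one
  primes that the route's quantum algorithm samples (random large factor bases) exist in EVERY class below
  a polynomial bound, unconditionally.

## References

* A. Weiss, *The least prime ideal*, J. reine angew. Math. 338 (1983) 56–94. [Weiss1983]
* J. Thorner, A. Zaman, *A unified and improved Chebotarev density theorem*, ANT 13 (2019). [ThornerZaman2019]
-/

noncomputable section

open Complex Real MeasureTheory Set Filter Topology
open scoped NumberField nonZeroDivisors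

namespace Summit.QuantumAdvantage.QuantumAdvantage.Theorems.DegreeOnePrimesEscape

open Literature.NumberTheory.LFunctions Literature.NumberTheory.LFunctions.NumberField
  Literature.NumberTheory.LFunctions.AbelianDensity

/-- **Per class, the primes of residue degree `≥ 2` are few**:
`π_C(x) − #{deg-1 primes ≤ x in C} ≤ [K:ℚ]·(√x + 1)` (sum the non-negative differences over all classes:
`Σ_C π_C = π_K ≤ Σ_C #deg-1 + n(√x+1)`). [folklore] -/
theorem primeIdealClassCount_sub_degOneClassCount_le (K : Type) [Field K] [NumberField K]
    (C : ClassGroup (𝓞 K)) {x : ℝ} (hx : 0 ≤ x) :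
    (primeIdealClassCount K C x : ℝ) - degOneClassCount K C x ≤
      (Module.finrank ℚ K : ℝ) * (Real.sqrt x + 1) := by
  classical
  have htot := primeIdealCount_le_sum_degOneClassCount_add K hx
  rw [← sum_primeIdealClassCount K x, Nat.cast_sum] at htot
  have hsum : ∑ D : ClassGroup (𝓞 K), ((primeIdealClassCount K D x : ℝ) - degOneClassCount K D x) ≤
      (Module.finrank ℚ K : ℝ) * (Real.sqrt x + 1) := by
    rw [Finset.sum_sub_distrib]; linarith
  refine le_trans ?_ hsum
  refine Finset.single_le_sum (f := fun D : ClassGroup (𝓞 K) =>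
    (primeIdealClassCount K D x : ℝ) - degOneClassCount K D x) (fun D _ => ?_) (Finset.mem_univ C)
  have := degOneClassCount_le K D x
  simp only [sub_nonneg, Nat.cast_le, this]

/-- `Li(x) ≥ x^{3/4}/8` for `x ≥ 4` (`Li(x) ≥ (x−2)/log x ≥ x/(2 log x)` and `log x ≤ 4x^{1/4}`).
[folklore] -/
theorem rpow_three_quarters_le_offsetLogIntegral {x : ℝ} (hx : 4 ≤ x) :
    x ^ (3 / 4 : ℝ) / 8 ≤ offsetLogIntegral x := by
  have hx0 : 0 < x := by linarith
  have hlogx : 0 < Real.log x := Real.log_pos (by linarith)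
  have hLix : (x - 2) * (Real.log x)⁻¹ ≤ offsetLogIntegral x := by
    have := sub_mul_inv_log_pow_le_offsetLogIntegralPow 1 (show (2:ℝ) ≤ x by linarith)
    rwa [pow_one, offsetLogIntegralPow_one] at this
  have hlog4 : Real.log x ≤ 4 * x ^ (1 / 4 : ℝ) := by
    have := Real.log_le_rpow_div hx0.le (by norm_num : (0:ℝ) < 1 / 4)
    linarith
  have hx14 : 0 < x ^ (1 / 4 : ℝ) := Real.rpow_pos_of_pos hx0 _
  have hsplit : x = x ^ (1 / 4 : ℝ) * x ^ (3 / 4 : ℝ) := by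
    rw [← Real.rpow_add hx0]; norm_num
  -- `x/(2 log x) ≥ x^{3/4}/8`
  have h1 : x ^ (3 / 4 : ℝ) / 8 ≤ x / (2 * Real.log x) := by
    rw [div_le_div_iff₀ (by norm_num) (by positivity)]
    calc x ^ (3 / 4 : ℝ) * (2 * Real.log x) ≤ x ^ (3 / 4 : ℝ) * (2 * (4 * x ^ (1 / 4 : ℝ))) := by
          gcongr
      _ = (x ^ (1 / 4 : ℝ) * x ^ (3 / 4 : ℝ)) * 8 := by ring
      _ = x * 8 := by rw [← hsplit]
  have h2 : x / (2 * Real.log x) ≤ (x - 2) * (Real.log x)⁻¹ := by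
    rw [← div_eq_mul_inv, div_le_div_iff₀ (by positivity) hlogx]
    nlinarith
  linarith

/-- **Linnik's theorem for degree-one primes in ideal classes, odd degree.**  For odd `n > 1` there is
`L > 0` such that every ideal class `C` of every number field `K` of degree `n` contains a prime ideal `𝔭`
whose norm is a rational prime (residue degree one) with `N𝔭 ≤ Q^{L}`, `Q = |d_K|·nⁿ` — unconditionally.
(`π_C(Q^L) ≥ Li/(2h) ≥ Q^{3L/4}/(16 Q⁴)` exceeds the `≤ n(√x + 1) ≤ 2Q·Q^{L/2}` primes of degree `≥ 2`
once `L ≥ 28`.) [cite: Weiss1983, Theorem 6.4 (least prime ideal in a ray class; here a different proof in odd degree)] -/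
theorem exists_degOnePrime_mem_class_absNorm_le_of_odd (n : ℕ) (hn : 1 < n) (hodd : Odd n) :
    ∃ L : ℝ, 0 < L ∧ ∀ (K : Type) [Field K] [NumberField K], Module.finrank ℚ K = n →
      ∀ C : ClassGroup (𝓞 K), ∃ (P : Ideal (𝓞 K)) (hP : P ∈ (Ideal (𝓞 K))⁰), (Ideal.absNorm P).Prime ∧
        ClassGroup.mk0 ⟨P, hP⟩ = C ∧ (Ideal.absNorm P : ℝ) ≤ ThornerZaman.condQn K ^ L := by
  classical
  obtain ⟨c₁, hc₁, h⟩ := classPNT_eps_of_odd n hn hodd (by norm_num : (0:ℝ) < 1 / 2)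
  refine ⟨max c₁ 28, lt_max_of_lt_left hc₁, fun K _ _ hKn C => ?_⟩
  have hK : 1 < Module.finrank ℚ K := by rw [hKn]; exact hn
  set Q : ℝ := ThornerZaman.condQn K with hQ
  have hQ12 : (12 : ℝ) ≤ Q := ThornerZaman.twelve_le_condQn (K := K) hK
  have hQ1 : (1 : ℝ) < Q := by linarith
  have hQ0 : (0 : ℝ) < Q := by linarith
  set L : ℝ := max c₁ 28 with hL
  set x : ℝ := Q ^ L with hx
  have hx₁ : Q ^ c₁ ≤ x := Real.rpow_le_rpow_of_exponent_le hQ1.le (le_max_left _ _)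
  have hx0 : 0 < x := Real.rpow_pos_of_pos hQ0 _
  -- `x^{1/4} ≥ Q⁷ ≥ 144 Q⁵`
  have hx14 : Q ^ (7 : ℝ) ≤ x ^ (1 / 4 : ℝ) := by
    rw [hx, ← Real.rpow_mul hQ0.le]
    exact Real.rpow_le_rpow_of_exponent_le hQ1.le (by
      have : (28:ℝ) ≤ L := le_max_right _ _; linarith)
  have hQ7 : 144 * Q ^ (5 : ℝ) ≤ Q ^ (7 : ℝ) := by
    have h75 : Q ^ (7 : ℝ) = Q ^ (2 : ℝ) * Q ^ (5 : ℝ) := by rw [← Real.rpow_add hQ0]; norm_num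
    rw [h75]
    have hQ2 : (144 : ℝ) ≤ Q ^ (2 : ℝ) := by
      rw [show (2 : ℝ) = (2 : ℕ) by norm_num, Real.rpow_natCast]; nlinarith
    exact mul_le_mul_of_nonneg_right hQ2 (by positivity)
  have hxQ : Q ≤ x := by
    have := Real.rpow_le_rpow_of_exponent_le hQ1.le (show (1:ℝ) ≤ L from le_trans (by norm_num) (le_max_right _ _))
    rwa [Real.rpow_one] at this
  have hx4 : (4 : ℝ) ≤ x := by linarith
  -- class number and degree against `Q`
  set hcl : ℝ := (NumberField.classNumber K : ℝ) with hh
  have hh0 : 0 < hcl := by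
    rw [hh]; exact_mod_cast Nat.lt_of_lt_of_le Nat.zero_lt_one (one_le_classNumber (K := K))
  have hhQ : hcl ≤ Q ^ (4 : ℝ) := by
    have := ThornerZaman.classNumber_le_condQn_pow (K := K) hK
    rw [show (4 : ℝ) = (4 : ℕ) by norm_num, Real.rpow_natCast]; exact this
  have hnQ : (Module.finrank ℚ K : ℝ) ≤ Q := ThornerZaman.finrank_le_condQn (K := K)
  -- the lower bound for `π_C(x)` and the degree-`≥ 2` count
  have hπ : offsetLogIntegral x / (2 * hcl) ≤ (primeIdealClassCount K C x : ℝ) := by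
    have h1 := (abs_sub_le_iff.mp (h K hKn C x hx₁)).2
    have : offsetLogIntegral x / hcl - 1 / 2 * offsetLogIntegral x / hcl = offsetLogIntegral x / (2 * hcl) := by
      field_simp; ring
    linarith
  have hLi : x ^ (3 / 4 : ℝ) / 8 ≤ offsetLogIntegral x := rpow_three_quarters_le_offsetLogIntegral hx4
  have hdeg := primeIdealClassCount_sub_degOneClassCount_le K C hx0.le
  -- `n(√x + 1) < Li(x)/(2h)`
  have hsqrt : Real.sqrt x = x ^ (1 / 2 : ℝ) := Real.sqrt_eq_rpow x
  have hx34 : x ^ (3 / 4 : ℝ) = x ^ (1 / 4 : ℝ) * x ^ (1 / 2 : ℝ) := by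
    rw [← Real.rpow_add hx0]; norm_num
  have hx12 : 1 ≤ x ^ (1 / 2 : ℝ) := Real.one_le_rpow (by linarith) (by norm_num)
  have hkey : (Module.finrank ℚ K : ℝ) * (Real.sqrt x + 1) < offsetLogIntegral x / (2 * hcl) := by
    have hQ5 : 0 < Q ^ (5 : ℝ) := by positivity
    -- `n(√x+1) ≤ 2 Q x^{1/2}`
    have hA : (Module.finrank ℚ K : ℝ) * (Real.sqrt x + 1) ≤ 2 * Q * x ^ (1 / 2 : ℝ) := by
      rw [hsqrt]
      have hn0 : (0:ℝ) ≤ (Module.finrank ℚ K : ℝ) := Nat.cast_nonneg _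
      nlinarith
    -- `Li/(2h) ≥ x^{3/4}/(16 Q⁴)`
    have hB : x ^ (3 / 4 : ℝ) / (16 * Q ^ (4 : ℝ)) ≤ offsetLogIntegral x / (2 * hcl) := by
      calc x ^ (3 / 4 : ℝ) / (16 * Q ^ (4 : ℝ)) ≤ x ^ (3 / 4 : ℝ) / (16 * hcl) := by
            apply div_le_div_of_nonneg_left (by positivity) (by positivity)
            nlinarith
        _ = (x ^ (3 / 4 : ℝ) / 8) / (2 * hcl) := by field_simp; ring
        _ ≤ offsetLogIntegral x / (2 * hcl) := by
            apply div_le_div_of_nonneg_right hLi (by positivity)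
    -- `2 Q x^{1/2} < x^{3/4}/(16 Q⁴)` since `x^{1/4} ≥ 144 Q⁵ > 32 Q⁵`
    have hC : 2 * Q * x ^ (1 / 2 : ℝ) < x ^ (3 / 4 : ℝ) / (16 * Q ^ (4 : ℝ)) := by
      rw [lt_div_iff₀ (by positivity), hx34]
      have h45 : Q * Q ^ (4 : ℝ) = Q ^ (5 : ℝ) := by
        rw [show (5 : ℝ) = 1 + 4 by norm_num, Real.rpow_add hQ0, Real.rpow_one]
      have : 2 * Q * x ^ (1 / 2 : ℝ) * (16 * Q ^ (4 : ℝ)) = 32 * Q ^ (5 : ℝ) * x ^ (1 / 2 : ℝ) := by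
        rw [← h45]; ring
      rw [this]
      have h144 : 144 * Q ^ (5 : ℝ) ≤ x ^ (1 / 4 : ℝ) := hQ7.trans hx14
      have hxhalf : 0 < x ^ (1 / 2 : ℝ) := by positivity
      nlinarith [mul_le_mul_of_nonneg_right h144 hxhalf.le, mul_pos hQ5 hxhalf]
    linarith
  -- hence a degree-one prime exists in `C` below `x`
  have hpos : 0 < (degOneClassCount K C x : ℝ) := by linarith
  have hne : degOneClassCount K C x ≠ 0 := by
    intro h0; rw [h0, Nat.cast_zero] at hpos; exact lt_irrefl _ hpos
  obtain ⟨P, hPprime, hPx, hP0, hPC⟩ := Set.nonempty_of_ncard_ne_zero hne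
  exact ⟨P, hP0, hPprime, hPC, hPx⟩

/-- **Cubic fields: every ideal class contains a degree-one prime ideal of norm `≤ (27|d_K|)^{L}`**
for an absolute `L > 0`, unconditionally — the degree-one primes sampled by the route's quantum
class-group algorithm exist in every class below a polynomial bound. -/
theorem exists_degOnePrime_mem_class_absNorm_le_cubic :
    ∃ L : ℝ, 0 < L ∧ ∀ (K : Type) [Field K] [NumberField K], Module.finrank ℚ K = 3 →
      ∀ C : ClassGroup (𝓞 K), ∃ (P : Ideal (𝓞 K)) (hP : P ∈ (Ideal (𝓞 K))⁰), (Ideal.absNorm P).Prime ∧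
        ClassGroup.mk0 ⟨P, hP⟩ = C ∧ (Ideal.absNorm P : ℝ) ≤ ThornerZaman.condQn K ^ L :=
  exists_degOnePrime_mem_class_absNorm_le_of_odd 3 (by norm_num) ⟨1, rfl⟩

end Summit.QuantumAdvantage.QuantumAdvantage.Theorems.DegreeOnePrimesEscape

end
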